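import Mathlib
import Literature.Analysis.FluidPDE.SteadyNSLatticePersistenceDrift
import Literature.Analysis.FunctionSpaces.TorusAgmonLatticeSum
import HarnessLib

/-!
# Generic leaf-nondegeneracy (stub B of crux `WindLine.WindyGalerkinSteadyZerothLaw`,
# stmt-AnomalousDissipation-11414), tools A: lattice interpolation and bilinear estimates

Helper layer (pure proof file, no definitions) for the properness of the drifted steady
Navier–Stokes map `G(x) = 4π²ν x + D_M x + B(x,x)` on the state space `W ⊂ ℓ²(ℤ³; ℂ³)` of
`Literature/Analysis/FluidPDE/SteadyNSLatticePersistence.lean` (`SteadyLattice.*`):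

* `sq_tsum_enorm_cf_le_agmon` — the lattice **Agmon interpolation**
  `(∑ₘ ‖x̌(m)‖)² ≤ C_A ‖x̌‖_{H¹} ‖x‖` (`x̌ = cf x`, `‖x̌‖²_{H¹} = Lattice.eNormSq 1 x̌`), from the weighted
  Cauchy–Schwarz inequality with the Agmon weights `ρ/(μₖ(μₖ+ρ))` and the tree's lattice sum
  `∑_{k≠0} ρ/(μₖ(μₖ+ρ)) ≤ C ρ^{1/2}` (`Torus.tsum_agmonWeight_le`), optimised in `ρ`;
* `tsum_enorm_sq_leray_nl_le` — the **bilinear estimate**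
  `∑ₖ ‖Π_k N(x̌, g)(k)‖² ≤ (18π)² (∑ₘ ‖x̌ m‖)² ‖g‖²_{H¹}` (`SteadyLattice.enorm_nl_le` and Young);
* `tsum_enorm_sq_drift_le` — the **drift estimate** `∑ₖ ‖2πi (k·M) x̌(k)‖² ≤ 36π² ‖M‖² ‖x̌‖²_{H¹}`;
* `eNormSq_one_cf_le`, `eNormSq_two_cf_le` — `‖x̌‖²_{H¹} ≤ ‖x̌‖²_{H²} ≤ 4 ‖x‖²`.

References: Foias–Manley–Rosa–Temam 2001, App. A (A.29) (Agmon); Temam 1979 Ch. II §1;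
Foias–Temam, CPAM 30 (1977) §1 (properness of the steady map).
-/

noncomputable section

-- D-0017: single-problem summit ⇒ the duplicated namespace segment is by design.
set_option linter.dupNamespace false

open scoped BigOperators Topology ENNReal NNReal InnerProductSpace ComplexConjugate
open Filter Set Function TopologicalSpace MeasureTheory UnitAddTorus
open Literature.Analysis.FunctionSpaces Literature.Analysis.FunctionSpaces.Torus
open Literature.Analysis.FunctionSpaces.EuclideanSpace
open Literature.Analysis.FluidPDE Literature.Analysis.FluidPDE.Torus
open Literature.Analysis.FluidPDE.ScalarFourier
open Literature.Analysis.FluidPDE.SteadyLattice Literature.Analysis.FluidPDE.SteadyLatticeDrift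

namespace Summit.AnomalousDissipation.AnomalousDissipation.Theorems.WindLineWindyGalerkinSteadyZerothLaw.GenericLeaf

/-- Complex coefficient vectors (local notation). -/
local notation "ℂ³" => EuclideanSpace ℂ (Fin 3)
/-- Square-summable coefficient families `ℤ³ → ℂ³` (local notation). -/
local notation "ℓ2" => lp (fun _ : Fin 3 → ℤ => EuclideanSpace ℂ (Fin 3)) 2
/-- Physical coefficients `x̌(k) = x(k)/|k|²` of a family (local notation, the tree's `cf`). -/
local notation "cf[" X "]" =>
  ((fun mm : Fin 3 → ℤ => (((freqNormSq mm)⁻¹ : ℝ) : ℂ)) • (X : (Fin 3 → ℤ) → EuclideanSpace ℂ (Fin 3)))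
/-- `k · v = ∑ⱼ kⱼ vⱼ` (local notation, the tree's `kdot`). -/
local notation "kdot[" k "," v "]" =>
  (∑ jj : Fin 3, (((k : Fin 3 → ℤ) jj : ℤ) : ℂ) * (v : EuclideanSpace ℂ (Fin 3)) jj)
/-- The convective symbol `N(a, b)(k)` as a vector of `ℂ³` (local notation, the tree's `nl`). -/
local notation "nl[" a "," b "," k "]" =>
  ((WithLp.toLp 2 (fun pp : Fin 3 => transportSym (fun jj mm => (a : (Fin 3 → ℤ) → EuclideanSpace ℂ (Fin 3)) mm jj)
    (fun mm => (b : (Fin 3 → ℤ) → EuclideanSpace ℂ (Fin 3)) mm pp) k)) : EuclideanSpace ℂ (Fin 3))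

/-! ## §1 Weighted norms of the physical coefficients -/

/-- `‖x̌ k‖ₑ = |k|⁻² ‖x k‖ₑ`. [folklore] -/
theorem enorm_cf_apply (x : (Fin 3 → ℤ) → ℂ³) (k : Fin 3 → ℤ) :
    ‖cf[x] k‖ₑ = ENNReal.ofReal ((freqNormSq k)⁻¹) * ‖x k‖ₑ := by
  rw [← ofReal_norm, norm_cf, ENNReal.ofReal_mul (inv_nonneg.2 (freqNormSq_nonneg k)), ofReal_norm]

/-- `⟨k⟩₂² |k|⁻⁴ ≤ 4`, i.e. `(1 + |k|²)² ≤ 4 |k|⁴` off the origin (and `0 ≤ 4` at it). [folklore] -/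
theorem sobolevWeight_two_sq_mul_inv_sq_le (k : Fin 3 → ℤ) :
    sobolevWeight 2 k ^ 2 * ((freqNormSq k)⁻¹) ^ 2 ≤ 4 := by
  by_cases hk : k = 0
  · subst hk
    simp [freqNormSq_zero]
  · have h1 : 1 ≤ freqNormSq k := one_le_freqNormSq' hk
    have hf : 0 < freqNormSq k := by linarith
    rw [SteadyNS.sobolevWeight_two, ← mul_pow]
    have h2 : (1 + freqNormSq k) * (freqNormSq k)⁻¹ ≤ 2 := by
      rw [← div_eq_mul_inv, div_le_iff₀ hf]
      linarith
    have h0 : 0 ≤ (1 + freqNormSq k) * (freqNormSq k)⁻¹ := by positivity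
    nlinarith

/-- `⟨k⟩₁² |k|⁻⁴ ≤ ⟨k⟩₂² |k|⁻⁴` (monotonicity of the weights). [folklore] -/
theorem sobolevWeight_one_sq_le_two_sq (k : Fin 3 → ℤ) : sobolevWeight 1 k ^ 2 ≤ sobolevWeight 2 k ^ 2 := by
  rw [sobolevWeight_one_sq, SteadyNS.sobolevWeight_two]
  nlinarith [freqNormSq_nonneg k]

/-- **`‖x̌‖²_{H²} ≤ 4 ‖x‖²`** for `x ∈ ℓ²`. [folklore] -/
theorem eNormSq_two_cf_le (x : ℓ2) : Lattice.eNormSq 2 cf[(x : (Fin 3 → ℤ) → ℂ³)] ≤ 4 * ‖x‖ₑ ^ 2 := by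
  rw [Lattice.eNormSq, l2_enorm_sq_eq_tsum, ← ENNReal.tsum_mul_left]
  refine ENNReal.tsum_le_tsum fun k => ?_
  rw [enorm_cf_apply, mul_pow, ← mul_assoc, ← ENNReal.ofReal_pow (inv_nonneg.2 (freqNormSq_nonneg k)),
    ← ENNReal.ofReal_mul (sq_nonneg _)]
  refine mul_le_mul_left ?_ _
  rw [← ENNReal.ofReal_ofNat]
  exact ENNReal.ofReal_le_ofReal (sobolevWeight_two_sq_mul_inv_sq_le k)

/-- **`‖x̌‖²_{H¹} ≤ ‖x̌‖²_{H²}`**. [folklore] -/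
theorem eNormSq_one_cf_le_two (x : (Fin 3 → ℤ) → ℂ³) : Lattice.eNormSq 1 cf[x] ≤ Lattice.eNormSq 2 cf[x] :=
  Lattice.eNormSq_mono (by norm_num) _

/-- **`‖x̌‖²_{H¹} ≤ 4 ‖x‖²`** for `x ∈ ℓ²`. [folklore] -/
theorem eNormSq_one_cf_le (x : ℓ2) : Lattice.eNormSq 1 cf[(x : (Fin 3 → ℤ) → ℂ³)] ≤ 4 * ‖x‖ₑ ^ 2 :=
  (eNormSq_one_cf_le_two _).trans (eNormSq_two_cf_le x)

/-- `‖x̌‖²_{H¹}` is finite on `ℓ²`. [folklore] -/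
theorem eNormSq_one_cf_ne_top (x : ℓ2) : Lattice.eNormSq 1 cf[(x : (Fin 3 → ℤ) → ℂ³)] ≠ ∞ :=
  ne_top_of_le_ne_top (ENNReal.mul_ne_top (by simp) (ENNReal.pow_ne_top enorm_ne_top)) (eNormSq_one_cf_le x)

/-- The `H¹`-type sum `∑ₖ |k|⁻² ‖x k‖² ≤ ‖x̌‖²_{H¹}` (termwise `|k|² ≤ 1 + |k|²`). [folklore] -/
theorem tsum_inv_mul_enorm_sq_le_eNormSq_one (x : (Fin 3 → ℤ) → ℂ³) :
    ∑' k, ENNReal.ofReal ((freqNormSq k)⁻¹) * ‖x k‖ₑ ^ 2 ≤ Lattice.eNormSq 1 cf[x] := by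
  refine ENNReal.tsum_le_tsum fun k => ?_
  rw [enorm_cf_apply, mul_pow, ← mul_assoc, ← ENNReal.ofReal_pow (inv_nonneg.2 (freqNormSq_nonneg k)),
    ← ENNReal.ofReal_mul (sq_nonneg _)]
  refine mul_le_mul_left (ENNReal.ofReal_le_ofReal ?_) _
  by_cases hk : k = 0
  · subst hk; simp [freqNormSq_zero]
  · have h1 : 1 ≤ freqNormSq k := one_le_freqNormSq' hk
    have hf : 0 < freqNormSq k := by linarith
    rw [sobolevWeight_one_sq]
    have e : (1 + freqNormSq k) * (freqNormSq k)⁻¹ ^ 2 = (freqNormSq k)⁻¹ * (freqNormSq k)⁻¹ + (freqNormSq k)⁻¹ := by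
      field_simp
    rw [e]
    nlinarith [inv_pos.2 hf]

/-! ## §2 The lattice Agmon interpolation -/

/-- `(∑ f g)² ≤ (∑ f²)(∑ g²)` in `ℝ≥0∞` (Cauchy–Schwarz, squared). [folklore] -/
theorem sq_tsum_mul_le {α : Type*} (f g : α → ℝ≥0∞) :
    (∑' m, f m * g m) ^ 2 ≤ (∑' m, f m ^ 2) * ∑' m, g m ^ 2 := by
  calc (∑' m, f m * g m) ^ 2 ≤ ((∑' m, f m ^ 2) ^ (1 / 2 : ℝ) * (∑' m, g m ^ 2) ^ (1 / 2 : ℝ)) ^ 2 :=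
        pow_le_pow_left' (cauchy_schwarz_ennreal f g) 2
    _ = (∑' m, f m ^ 2) * ∑' m, g m ^ 2 := by
        rw [mul_pow, ENNReal.rpow_half_sq, ENNReal.rpow_half_sq]

/-- The algebra of the Agmon weights off the origin: with `μ = 4π²|k|² > 0`, `ρ > 0`,
`w = ρ/(μ(μ+ρ))`: `√w · √(w⁻¹) = 1` and `w⁻¹ |k|⁻⁴ = 4π² |k|⁻² + 16π⁴/ρ`. [folklore] -/
theorem agmonWeight_inv_mul {ρ f : ℝ} (hρ : 0 < ρ) (hf : 0 < f) :
    (ρ / (4 * Real.pi ^ 2 * f * (4 * Real.pi ^ 2 * f + ρ)))⁻¹ * (f⁻¹) ^ 2 =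
      4 * Real.pi ^ 2 * f⁻¹ + 16 * Real.pi ^ 4 / ρ := by
  have hπ : 0 < Real.pi := Real.pi_pos
  field_simp
  ring

/-- **Agmon's interpolation inequality on the lattice** (Foias–Manley–Rosa–Temam 2001, (A.29), in
Fourier variables): there is a finite constant `C_A` with
`(∑ₘ ‖x̌(m)‖)² ≤ C_A ‖x̌‖_{H¹} ‖x‖` for every `x ∈ ℓ²(ℤ³; ℂ³)`, where `x̌ = cf x` and
`‖x̌‖²_{H¹} = Lattice.eNormSq 1 x̌`.  Proof: Cauchy–Schwarz with the Agmon weights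
`wₖ = ρ/(μₖ(μₖ+ρ))`, `μₖ = 4π²|k|²`, the lattice sum `∑_{k≠0} wₖ ≤ C₀ ρ^{1/2}`
(`Torus.tsum_agmonWeight_le`) and the choice `ρ = 4π² ‖x‖² / ∑ₖ |k|⁻²‖x k‖²`. [folklore] -/
theorem exists_agmon_const : ∃ C : ℝ≥0∞, C ≠ ∞ ∧ ∀ x : ℓ2,
    (∑' m, ‖cf[((x : ℓ2) : (Fin 3 → ℤ) → ℂ³)] m‖ₑ) ^ 2 ≤
      C * (Lattice.eNormSq 1 cf[((x : ℓ2) : (Fin 3 → ℤ) → ℂ³)]) ^ (1 / 2 : ℝ) * ‖x‖ₑ := by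
  obtain ⟨C₀, hC₀, hsum⟩ := Torus.tsum_agmonWeight_le (d := Fin 3) (Fintype.card_fin 3)
  refine ⟨ENNReal.ofReal (16 * Real.pi ^ 3 * C₀), ENNReal.ofReal_ne_top, fun x => ?_⟩
  have hπ : 0 < Real.pi := Real.pi_pos
  -- the sums `Q = ∑ |k|⁻² ‖x k‖²` and `‖x‖²`
  set Q : ℝ≥0∞ := ∑' k, ENNReal.ofReal ((freqNormSq k)⁻¹) * ‖((x : ℓ2) : (Fin 3 → ℤ) → ℂ³) k‖ₑ ^ 2 with hQ
  have hQle : Q ≤ Lattice.eNormSq 1 cf[((x : ℓ2) : (Fin 3 → ℤ) → ℂ³)] :=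
    tsum_inv_mul_enorm_sq_le_eNormSq_one _
  have hQP : Q ≤ ‖x‖ₑ ^ 2 := by
    rw [l2_enorm_sq_eq_tsum]
    refine ENNReal.tsum_le_tsum fun k => ?_
    calc ENNReal.ofReal ((freqNormSq k)⁻¹) * ‖((x : ℓ2) : (Fin 3 → ℤ) → ℂ³) k‖ₑ ^ 2
        ≤ 1 * ‖((x : ℓ2) : (Fin 3 → ℤ) → ℂ³) k‖ₑ ^ 2 := by
          refine mul_le_mul_left ?_ _
          rw [← ENNReal.ofReal_one]
          refine ENNReal.ofReal_le_ofReal ?_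
          by_cases hk : k = 0
          · subst hk; simp [freqNormSq_zero]
          · exact inv_le_one_of_one_le₀ (one_le_freqNormSq' hk)
      _ = _ := one_mul _
  have hQtop : Q ≠ ∞ := ne_top_of_le_ne_top (ENNReal.pow_ne_top enorm_ne_top) hQP
  by_cases hQ0 : Q = 0
  · -- then `x k = 0` for `k ≠ 0`, so `x̌ = 0` and the left-hand side vanishes
    have hcf : ∀ m, cf[((x : ℓ2) : (Fin 3 → ℤ) → ℂ³)] m = 0 := by
      intro m
      by_cases hm : m = 0
      · subst hm; exact cf_zero _
      · have h := ENNReal.tsum_eq_zero.1 hQ0 m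
        rw [mul_eq_zero] at h
        rcases h with h | h
        · exfalso
          have hf : 0 < (freqNormSq m)⁻¹ := inv_pos.2 (lt_of_lt_of_le one_pos (one_le_freqNormSq' hm))
          exact (ENNReal.ofReal_pos.2 hf).ne' h
        · rw [cf_apply, enorm_eq_zero.1 ((pow_eq_zero_iff two_ne_zero).1 h), smul_zero]
    have h0 : (∑' m, ‖cf[((x : ℓ2) : (Fin 3 → ℤ) → ℂ³)] m‖ₑ) = 0 := by
      rw [ENNReal.tsum_eq_zero]
      intro m
      rw [hcf m, enorm_zero]
    rw [h0]
    simp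
  -- main case: `Q > 0`, hence `‖x‖ > 0`; real versions `q = s²`, `‖x‖`
  have hxe0 : ‖x‖ₑ ≠ 0 := fun h0 => hQ0 (le_antisymm (hQP.trans (by rw [h0]; simp)) bot_le)
  have hxn : 0 < ‖x‖ := by
    rw [← ofReal_norm] at hxe0
    exact not_le.1 fun h => hxe0 (ENNReal.ofReal_eq_zero.2 h)
  have hq0 : 0 < Q.toReal := ENNReal.toReal_pos hQ0 hQtop
  obtain ⟨s, hs0, hs⟩ : ∃ s : ℝ, 0 < s ∧ Q.toReal = s ^ 2 :=
    ⟨Real.sqrt Q.toReal, Real.sqrt_pos.2 hq0, (Real.sq_sqrt hq0.le).symm⟩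
  have hQq : Q = ENNReal.ofReal (s ^ 2) := by rw [← hs, ENNReal.ofReal_toReal hQtop]
  -- the parameter `ρ` and the weights
  obtain ⟨ρ, hρ⟩ : ∃ ρ : ℝ, ρ = (2 * Real.pi * ‖x‖ / s) ^ 2 := ⟨_, rfl⟩
  have hρ0 : 0 < ρ := by rw [hρ]; positivity
  have hρs : 16 * Real.pi ^ 4 / ρ * ‖x‖ ^ 2 = 4 * Real.pi ^ 2 * s ^ 2 := by
    rw [hρ]
    field_simp
    norm_num
  have hsqrtρ : ρ ^ (1 / 2 : ℝ) = 2 * Real.pi * ‖x‖ / s := by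
    rw [← Real.sqrt_eq_rpow, hρ, Real.sqrt_sq (by positivity)]
  set w : (Fin 3 → ℤ) → ℝ := fun k => if k = 0 then (0 : ℝ) else
    ρ / (4 * Real.pi ^ 2 * freqNormSq k * (4 * Real.pi ^ 2 * freqNormSq k + ρ)) with hw
  have hw0 : ∀ k, 0 ≤ w k := fun k => by
    simp only [hw]
    split_ifs
    · exact le_rfl
    · have := freqNormSq_nonneg k; positivity
  have hwpos : ∀ k, k ≠ 0 → 0 < w k := fun k hk => by
    simp only [hw, if_neg hk]
    have h1 : 1 ≤ freqNormSq k := one_le_freqNormSq' hk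
    positivity
  have hws : Summable w := Torus.summable_agmonWeight (d := Fin 3) (by simp) hρ0
  set f : (Fin 3 → ℤ) → ℝ≥0∞ := fun k => ENNReal.ofReal (Real.sqrt (w k)) with hf
  set g : (Fin 3 → ℤ) → ℝ≥0∞ := fun k => ENNReal.ofReal (Real.sqrt ((w k)⁻¹)) *
    ‖cf[((x : ℓ2) : (Fin 3 → ℤ) → ℂ³)] k‖ₑ with hg
  -- `∑ ‖x̌ m‖ = ∑ f g`
  have hfg : ∀ m, ‖cf[((x : ℓ2) : (Fin 3 → ℤ) → ℂ³)] m‖ₑ = f m * g m := by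
    intro m
    by_cases hm : m = 0
    · subst hm; simp [hf, hg]
    · simp only [hf, hg]
      rw [← mul_assoc, ← ENNReal.ofReal_mul (Real.sqrt_nonneg _), ← Real.sqrt_mul (hw0 m),
        mul_inv_cancel₀ (hwpos m hm).ne', Real.sqrt_one, ENNReal.ofReal_one, one_mul]
  -- `∑ f² ≤ C₀ ρ^{1/2}`
  have hf2 : ∑' m, f m ^ 2 ≤ ENNReal.ofReal (C₀ * ρ ^ (1 / 2 : ℝ)) := by
    have e : ∀ m, f m ^ 2 = ENNReal.ofReal (w m) := fun m => by
      simp only [hf]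
      rw [← ENNReal.ofReal_pow (Real.sqrt_nonneg _), Real.sq_sqrt (hw0 m)]
    simp_rw [e]
    rw [← ENNReal.ofReal_tsum_of_nonneg hw0 hws]
    exact ENNReal.ofReal_le_ofReal (hsum ρ hρ0)
  -- `∑ g² ≤ 4π² Q + (16π⁴/ρ) ‖x‖²`
  have hg2 : ∑' m, g m ^ 2 ≤
      ENNReal.ofReal (4 * Real.pi ^ 2) * Q + ENNReal.ofReal (16 * Real.pi ^ 4 / ρ) * ‖x‖ₑ ^ 2 := by
    rw [hQ, l2_enorm_sq_eq_tsum, ← ENNReal.tsum_mul_left, ← ENNReal.tsum_mul_left, ← ENNReal.tsum_add]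
    refine ENNReal.tsum_le_tsum fun m => ?_
    by_cases hm : m = 0
    · subst hm; simp [hg]
    · simp only [hg]
      have hfm : 0 < freqNormSq m := lt_of_lt_of_le one_pos (one_le_freqNormSq' hm)
      rw [mul_pow, ← ENNReal.ofReal_pow (Real.sqrt_nonneg _), Real.sq_sqrt (inv_nonneg.2 (hw0 m)),
        enorm_cf_apply, mul_pow, ← mul_assoc, ← ENNReal.ofReal_pow (inv_nonneg.2 hfm.le),
        ← ENNReal.ofReal_mul (inv_nonneg.2 (hw0 m)), ← mul_assoc, ← add_mul,
        ← ENNReal.ofReal_mul (by positivity), ← ENNReal.ofReal_add (by positivity) (by positivity)]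
      refine mul_le_mul_left (ENNReal.ofReal_le_ofReal (le_of_eq ?_)) _
      simp only [hw, if_neg hm]
      exact agmonWeight_inv_mul hρ0 hfm
  -- assemble
  have hxe : ‖x‖ₑ = ENNReal.ofReal ‖x‖ := (ofReal_norm x).symm
  have hreal : C₀ * ρ ^ (1 / 2 : ℝ) * (4 * Real.pi ^ 2 * s ^ 2 + 16 * Real.pi ^ 4 / ρ * ‖x‖ ^ 2) =
      16 * Real.pi ^ 3 * C₀ * (s * ‖x‖) := by
    rw [hρs, hsqrtρ]
    field_simp
    ring
  calc (∑' m, ‖cf[((x : ℓ2) : (Fin 3 → ℤ) → ℂ³)] m‖ₑ) ^ 2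
      = (∑' m, f m * g m) ^ 2 := by rw [tsum_congr hfg]
    _ ≤ (∑' m, f m ^ 2) * ∑' m, g m ^ 2 := sq_tsum_mul_le f g
    _ ≤ ENNReal.ofReal (C₀ * ρ ^ (1 / 2 : ℝ)) *
          (ENNReal.ofReal (4 * Real.pi ^ 2) * Q + ENNReal.ofReal (16 * Real.pi ^ 4 / ρ) * ‖x‖ₑ ^ 2) :=
        mul_le_mul' hf2 hg2
    _ = ENNReal.ofReal (16 * Real.pi ^ 3 * C₀ * (s * ‖x‖)) := by
        rw [hQq, hxe, ← ENNReal.ofReal_pow (norm_nonneg _), ← ENNReal.ofReal_mul (by positivity),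
          ← ENNReal.ofReal_mul (by positivity), ← ENNReal.ofReal_add (by positivity) (by positivity),
          ← ENNReal.ofReal_mul (by positivity), hreal]
    _ ≤ ENNReal.ofReal (16 * Real.pi ^ 3 * C₀) *
          (Lattice.eNormSq 1 cf[((x : ℓ2) : (Fin 3 → ℤ) → ℂ³)]) ^ (1 / 2 : ℝ) * ‖x‖ₑ := by
        rw [ENNReal.ofReal_mul (by positivity), ENNReal.ofReal_mul hs0.le, ← hxe, ← mul_assoc]
        refine mul_le_mul_left (mul_le_mul_right ?_ _) _
        calc ENNReal.ofReal s = Q ^ (1 / 2 : ℝ) := by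
              rw [hQq, ENNReal.ofReal_rpow_of_nonneg (sq_nonneg _) (by norm_num), ← Real.sqrt_eq_rpow,
                Real.sqrt_sq hs0.le]
          _ ≤ _ := ENNReal.rpow_le_rpow hQle (by norm_num)

/-! ## §3 The bilinear and drift estimates on coefficient families -/

/-- **Bilinear estimate** (`ℓ¹ × H¹ → ℓ²` for the projected convective symbol):
`∑ₖ ‖Π_k N(x̌, g)(k)‖² ≤ (18π)² (∑ₘ ‖x̌ m‖)² ‖g‖²_{H¹}` (`SteadyLattice.enorm_nl_le`, the Leray
symbol contracts, and Young `ℓ¹ ⋆ ℓ² ⊂ ℓ²`). [folklore] -/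
theorem tsum_enorm_sq_leray_nl_le (x g : (Fin 3 → ℤ) → ℂ³) :
    ∑' k, ‖lerayCoeff k nl[cf[x], g, k]‖ₑ ^ 2 ≤
      ENNReal.ofReal (18 * Real.pi) ^ 2 * ((∑' m, ‖cf[x] m‖ₑ) ^ 2 * Lattice.eNormSq 1 g) := by
  set F : (Fin 3 → ℤ) → ℝ≥0∞ := fun m => ‖cf[x] m‖ₑ with hF
  set G : (Fin 3 → ℤ) → ℝ≥0∞ := fun l => ENNReal.ofReal (sobolevWeight 1 l) * ‖g l‖ₑ with hG
  have hpt : ∀ k, ‖lerayCoeff k nl[cf[x], g, k]‖ₑ ≤ ENNReal.ofReal (18 * Real.pi) * ∑' m, F m * G (k - m) :=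
    fun k => (enorm_lerayCoeff_le k _).trans (enorm_nl_le _ _ k)
  have hG2 : ∑' l, G l ^ 2 = Lattice.eNormSq 1 g := by
    simp only [hG, Lattice.eNormSq]
    refine tsum_congr fun l => ?_
    rw [mul_pow, ENNReal.ofReal_pow (sobolevWeight_pos 1 l).le]
  calc ∑' k, ‖lerayCoeff k nl[cf[x], g, k]‖ₑ ^ 2
      ≤ ∑' k, (ENNReal.ofReal (18 * Real.pi) * ∑' m, F m * G (k - m)) ^ 2 :=
        ENNReal.tsum_le_tsum fun k => pow_le_pow_left' (hpt k) 2
    _ = ENNReal.ofReal (18 * Real.pi) ^ 2 * ∑' k, (∑' m, F m * G (k - m)) ^ 2 := by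
        rw [← ENNReal.tsum_mul_left]
        exact tsum_congr fun k => by rw [mul_pow]
    _ ≤ ENNReal.ofReal (18 * Real.pi) ^ 2 * ((∑' m, F m) ^ 2 * ∑' l, G l ^ 2) :=
        mul_le_mul_right (young_one_two F G) _
    _ = _ := by rw [hG2]

/-- **Drift estimate**: `∑ₖ ‖2πi (k·M) x̌(k)‖² ≤ (6π‖M‖)² ‖x̌‖²_{H¹}` (`|2πi (k·M)| ≤ 6π ⟨k⟩ ‖M‖`,
`SteadyLatticeDrift.norm_driftCoeff_le`). [folklore] -/
theorem tsum_enorm_sq_drift_le (M : ℂ³) (x : (Fin 3 → ℤ) → ℂ³) :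
    ∑' k, ‖(2 * Real.pi * Complex.I * kdot[k, M]) • cf[x] k‖ₑ ^ 2 ≤
      ENNReal.ofReal ((6 * Real.pi * ‖M‖) ^ 2) * Lattice.eNormSq 1 cf[x] := by
  rw [Lattice.eNormSq, ← ENNReal.tsum_mul_left]
  refine ENNReal.tsum_le_tsum fun k => ?_
  rw [enorm_smul, mul_pow, ← mul_assoc]
  refine mul_le_mul_left ?_ _
  rw [← ofReal_norm, ← ENNReal.ofReal_pow (norm_nonneg _), ← ENNReal.ofReal_mul (sq_nonneg _)]
  refine ENNReal.ofReal_le_ofReal ?_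
  have h := norm_driftCoeff_le M k
  have h0 : 0 ≤ ‖(2 * Real.pi * Complex.I * kdot[k, M] : ℂ)‖ := norm_nonneg _
  calc ‖(2 * Real.pi * Complex.I * kdot[k, M] : ℂ)‖ ^ 2 ≤ (2 * Real.pi * (3 * sobolevWeight 1 k * ‖M‖)) ^ 2 :=
        pow_le_pow_left₀ h0 h 2
    _ = (6 * Real.pi * ‖M‖) ^ 2 * sobolevWeight 1 k ^ 2 := by ring

/-! ## §4 The estimates on the state space `W` -/

section StateSpace

variable {W : Submodule ℝ ℓ2}
variable (B : W → W → W)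
variable (hB : ∀ x y : W, (((B x y : W) : ℓ2) : (Fin 3 → ℤ) → ℂ³) = fun k =>
  lerayCoeff k nl[cf[((x : ℓ2) : (Fin 3 → ℤ) → ℂ³)], cf[((y : ℓ2) : (Fin 3 → ℤ) → ℂ³)], k])
include hB

/-- **Norm of the bilinear map**: `‖B(x, y)‖ ≤ 18π (∑ₘ ‖x̌ m‖) ‖y̌‖_{H¹}` in `ℝ≥0∞`. [folklore] -/
theorem enorm_B_le (x y : W) :
    ‖B x y‖ₑ ≤ ENNReal.ofReal (18 * Real.pi) * (∑' m, ‖cf[((x : ℓ2) : (Fin 3 → ℤ) → ℂ³)] m‖ₑ) *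
      (Lattice.eNormSq 1 cf[((y : ℓ2) : (Fin 3 → ℤ) → ℂ³)]) ^ (1 / 2 : ℝ) := by
  have h : ‖((B x y : W) : ℓ2)‖ₑ ^ 2 ≤ (ENNReal.ofReal (18 * Real.pi) * (∑' m, ‖cf[((x : ℓ2) : (Fin 3 → ℤ) → ℂ³)] m‖ₑ) *
      (Lattice.eNormSq 1 cf[((y : ℓ2) : (Fin 3 → ℤ) → ℂ³)]) ^ (1 / 2 : ℝ)) ^ 2 := by
    rw [l2_enorm_sq_eq_tsum, hB, mul_pow, mul_pow, ENNReal.rpow_half_sq, mul_assoc]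
    exact tsum_enorm_sq_leray_nl_le _ _
  exact (ENNReal.pow_le_pow_left_iff two_ne_zero).1 h

/-- **Difference of the quadratic map**: `B(x,x) − B(y,y) = B(x − y, x) + B(y, x − y)`, hence
`‖B(x,x) − B(y,y)‖ ≤ 18π ((∑‖(x−y)̌‖) ‖x̌‖_{H¹} + (∑‖y̌‖) ‖(x−y)̌‖_{H¹})`. [folklore] -/
theorem enorm_B_self_sub_le (hBb : IsBoundedBilinearMap ℝ (fun p : W × W => B p.1 p.2)) (x y : W) :
    ‖B x x - B y y‖ₑ ≤ ENNReal.ofReal (18 * Real.pi) *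
      ((∑' m, ‖cf[(((x - y : W) : ℓ2) : (Fin 3 → ℤ) → ℂ³)] m‖ₑ) *
          (Lattice.eNormSq 1 cf[((x : ℓ2) : (Fin 3 → ℤ) → ℂ³)]) ^ (1 / 2 : ℝ) +
        (∑' m, ‖cf[((y : ℓ2) : (Fin 3 → ℤ) → ℂ³)] m‖ₑ) *
          (Lattice.eNormSq 1 cf[(((x - y : W) : ℓ2) : (Fin 3 → ℤ) → ℂ³)]) ^ (1 / 2 : ℝ)) := by
  have e : B x x - B y y = B (x - y) x + B y (x - y) := by
    have h1 : B (x - y) x = B x x - B y x := hBb.map_sub_left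
    have h2 : B y (x - y) = B y x - B y y := hBb.map_sub_right
    rw [h1, h2]; abel
  rw [e, mul_add]
  refine (enorm_add_le _ _).trans (add_le_add ?_ ?_)
  · rw [← mul_assoc]; exact enorm_B_le B hB (x - y) x
  · rw [← mul_assoc]; exact enorm_B_le B hB y (x - y)

omit hB in
/-- **Norm of the drift**: `‖D_M x‖ ≤ 6π ‖M‖ ‖x̌‖_{H¹}` in `ℝ≥0∞`. [folklore] -/
theorem enorm_D_le {M : ℂ³} (D : W →L[ℝ] W)
    (hD : ∀ x : W, (((D x : W) : ℓ2) : (Fin 3 → ℤ) → ℂ³) = fun k =>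
      (2 * Real.pi * Complex.I * kdot[k, M]) • cf[((x : ℓ2) : (Fin 3 → ℤ) → ℂ³)] k) (x : W) :
    ‖D x‖ₑ ≤ ENNReal.ofReal (6 * Real.pi * ‖M‖) * (Lattice.eNormSq 1 cf[((x : ℓ2) : (Fin 3 → ℤ) → ℂ³)]) ^ (1 / 2 : ℝ) := by
  have h : ‖((D x : W) : ℓ2)‖ₑ ^ 2 ≤ (ENNReal.ofReal (6 * Real.pi * ‖M‖) *
      (Lattice.eNormSq 1 cf[((x : ℓ2) : (Fin 3 → ℤ) → ℂ³)]) ^ (1 / 2 : ℝ)) ^ 2 := by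
    rw [l2_enorm_sq_eq_tsum, hD, mul_pow, ENNReal.rpow_half_sq, ← ENNReal.ofReal_pow (by positivity)]
    exact tsum_enorm_sq_drift_le M _
  exact (ENNReal.pow_le_pow_left_iff two_ne_zero).1 h

end StateSpace

/-! ## §5 Registered sub-goal -/

/-- **Registered sub-goal `genericLeaf_toolsA`** (worker B of stub `stub_genericLeafNondegeneracy`): the
lattice Agmon interpolation `exists_agmon_const`, in notation-free Pi-form. [folklore] -/
theorem genericLeaf_toolsA : ∃ C : ENNReal, C ≠ ⊤ ∧ ∀ x : lp (fun _ : Fin 3 → ℤ => EuclideanSpace ℂ (Fin 3)) 2, (∑' m, ‖((fun mm : Fin 3 → ℤ => (((freqNormSq mm)⁻¹ : ℝ) : ℂ)) • ((x : lp (fun _ : Fin 3 → ℤ => EuclideanSpace ℂ (Fin 3)) 2) : (Fin 3 → ℤ) → EuclideanSpace ℂ (Fin 3))) m‖ₑ) ^ 2 ≤ C * (Lattice.eNormSq 1 ((fun mm : Fin 3 → ℤ => (((freqNormSq mm)⁻¹ : ℝ) : ℂ)) • ((x : lp (fun _ : Fin 3 → ℤ => EuclideanSpace ℂ (Fin 3))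 2) : (Fin 3 → ℤ) → EuclideanSpace ℂ (Fin 3)))) ^ (1 / 2 : ℝ) * ‖x‖ₑ :=
  exists_agmon_const

end Summit.AnomalousDissipation.AnomalousDissipation.Theorems.WindLineWindyGalerkinSteadyZerothLaw.GenericLeaf

end
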